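import Summits.CriticalPhenomena.CardyFormulaZ2.Theorems.CardySusyWardDiscretisationFamilyExistsTransportB
import Summits.CriticalPhenomena.CardyFormulaZ2.Theorems.CardySusyWardDiscretisationFamilyExistsDefs
import HarnessLib

/-!
# Pull-back of leg data along a lattice isometry — helper for `DiscretisationFamilyExists` (stmt-CriticalPhenomena-9644)

`nonempty_legData_of_image`: if the image domain `G '' Ω` carries leg data at `(G a, η, G p)`,
then `Ω` carries leg data at `(a, η, p)` — every field of `LegData` is transported back along
the lattice isometry `(g, G)` (with its face bijection `gf` and the permutation `π` of the unit
directions induced by `g⁻¹`, which is a rotation or a reflection of the four directions: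
`cornerUnit (π (m+1)) = ± cornerUnit (π m + 1)`).  The dictionary is `…ExistsTransportA/B`.
-/

noncomputable section

open Set Metric
open Literature.Probability.LatticeModels Literature.Probability.Percolation
  Literature.Probability.LatticeModels.DiscreteDobrushin Literature.Topology.PlaneTopology

namespace Summit.CriticalPhenomena.CardyFormulaZ2.Theorems.DiscretisationFamilyExists

section Transport

variable {Ω : Set ℂ} {δ : ℝ} {g gf : Site 2 ≃ Site 2} {G : ℂ ≃ₗᵢ[ℝ] ℂ} {π : Fin 4 → Fin 4}

/-- `meshPoint` is odd. [folklore] -/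
theorem meshPoint_neg' (δ : ℝ) (v : Site 2) : meshPoint δ (-v) = -meshPoint δ v := by
  have := meshPoint_add δ v (-v)
  rw [add_neg_cancel] at this
  have h0 : meshPoint δ (0 : Site 2) = 0 := by
    apply Complex.ext <;> simp [meshPoint_re, meshPoint_im]
  rw [h0] at this
  linear_combination -this

/-- The unit directions along the inverse isometry: `G⁻¹ (δ e_m) = δ e_{π m}`. [folklore] -/
theorem symm_meshPoint_cornerUnit (hG : ∀ x : Site 2, meshPoint δ (g x) = G (meshPoint δ x))
    (hunit : ∀ (x : Site 2) (m : Fin 4), g.symm (x + cornerUnit m) = g.symm x + cornerUnit (π m))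
    (m : Fin 4) : G.symm (meshPoint δ (cornerUnit m)) = meshPoint δ (cornerUnit (π m)) := by
  have h := congrArg (meshPoint δ) (hunit 0 m)
  rw [zero_add, meshPoint_add, meshPoint_symm hG, meshPoint_symm hG, map_zero_pt] at h
  · simpa using h
where
  /-- `meshPoint δ 0 = 0` -/
  map_zero_pt : meshPoint δ (0 : Site 2) = 0 := by
    apply Complex.ext <;> simp [meshPoint_re, meshPoint_im]

/-- The unit directions along the isometry: `G (δ e_{π m}) = δ e_m`. [folklore] -/
theorem map_meshPoint_cornerUnit (hG : ∀ x : Site 2, meshPoint δ (g x) = G (meshPoint δ x))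
    (hunit : ∀ (x : Site 2) (m : Fin 4), g.symm (x + cornerUnit m) = g.symm x + cornerUnit (π m))
    (m : Fin 4) : G (meshPoint δ (cornerUnit (π m))) = meshPoint δ (cornerUnit m) := by
  rw [← symm_meshPoint_cornerUnit hG hunit m, LinearIsometryEquiv.apply_symm_apply]

/-- `π` commutes with the half-turn: `δ e_{π m + 2} ↦ δ e_{m+2}`. [folklore] -/
theorem map_meshPoint_cornerUnit_add_two (hG : ∀ x : Site 2, meshPoint δ (g x) = G (meshPoint δ x))
    (hunit : ∀ (x : Site 2) (m : Fin 4), g.symm (x + cornerUnit m) = g.symm x + cornerUnit (π m))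
    (m : Fin 4) : G (meshPoint δ (cornerUnit (π m + 2))) = meshPoint δ (cornerUnit (m + 2)) := by
  rw [cornerUnit_add_two, cornerUnit_add_two, meshPoint_neg', meshPoint_neg', map_neg,
    map_meshPoint_cornerUnit hG hunit]

/-- The next direction: `G (δ e_{π m + 1}) = ± δ e_{m+1}`. [folklore] -/
theorem map_meshPoint_cornerUnit_add_one (hG : ∀ x : Site 2, meshPoint δ (g x) = G (meshPoint δ x))
    (hunit : ∀ (x : Site 2) (m : Fin 4), g.symm (x + cornerUnit m) = g.symm x + cornerUnit (π m))
    (hπ : ∀ m : Fin 4, cornerUnit (π (m + 1)) = cornerUnit (π m + 1) ∨ cornerUnit (π (m + 1)) = -cornerUnit (π m + 1))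
    (m : Fin 4) : G (meshPoint δ (cornerUnit (π m + 1))) = meshPoint δ (cornerUnit (m + 1)) ∨
      G (meshPoint δ (cornerUnit (π m + 1))) = -meshPoint δ (cornerUnit (m + 1)) := by
  rcases hπ m with h | h
  · left; rw [← h, map_meshPoint_cornerUnit hG hunit]
  · right
    have : cornerUnit (π m + 1) = -cornerUnit (π (m + 1)) := by rw [h, neg_neg]
    rw [this, meshPoint_neg', map_neg, map_meshPoint_cornerUnit hG hunit]

/-- The direction after next: `G (δ e_{π m + 2 + 1}) = ± δ e_{m+2+1}`. [folklore] -/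
theorem map_meshPoint_cornerUnit_add_two_add_one (hG : ∀ x : Site 2, meshPoint δ (g x) = G (meshPoint δ x))
    (hunit : ∀ (x : Site 2) (m : Fin 4), g.symm (x + cornerUnit m) = g.symm x + cornerUnit (π m))
    (hπ : ∀ m : Fin 4, cornerUnit (π (m + 1)) = cornerUnit (π m + 1) ∨ cornerUnit (π (m + 1)) = -cornerUnit (π m + 1))
    (m : Fin 4) : G (meshPoint δ (cornerUnit (π m + 2 + 1))) = meshPoint δ (cornerUnit (m + 2 + 1)) ∨
      G (meshPoint δ (cornerUnit (π m + 2 + 1))) = -meshPoint δ (cornerUnit (m + 2 + 1)) := by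
  have e1 : cornerUnit (π m + 2 + 1) = -cornerUnit (π m + 1) := by
    rw [add_right_comm (π m) 2 1, cornerUnit_add_two]
  have e2 : cornerUnit (m + 2 + 1) = -cornerUnit (m + 1) := by
    rw [add_right_comm m 2 1, cornerUnit_add_two]
  rw [e1, e2, meshPoint_neg', meshPoint_neg', map_neg]
  rcases map_meshPoint_cornerUnit_add_one hG hunit hπ m with h | h
  · left; rw [h]
  · right; rw [h, neg_neg]

/-- Distance to the frontier along the inverse isometry. [folklore] -/
theorem infDist_frontier_image' (G : ℂ ≃ₗᵢ[ℝ] ℂ) (Ω : Set ℂ) (w : ℂ) :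
    infDist (G.symm w) (frontier Ω) = infDist w (frontier (G '' Ω)) := by
  rw [← infDist_frontier_image G Ω (G.symm w), LinearIsometryEquiv.apply_symm_apply]

set_option maxHeartbeats 800000 in
/-- **Pull-back of leg data along a lattice isometry.** [folklore] -/
theorem nonempty_legData_of_image (hδ : 0 < δ) (hG : ∀ x : Site 2, meshPoint δ (g x) = G (meshPoint δ x))
    (hc : ∀ x f : Site 2, IsCorner (g x) (gf f) ↔ IsCorner x f)
    (hunit : ∀ (x : Site 2) (m : Fin 4), g.symm (x + cornerUnit m) = g.symm x + cornerUnit (π m))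
    (hπ : ∀ m : Fin 4, cornerUnit (π (m + 1)) = cornerUnit (π m + 1) ∨ cornerUnit (π (m + 1)) = -cornerUnit (π m + 1))
    {a p : ℂ} {η : ℝ} (hL : Nonempty (LegData (G '' Ω) δ (G a) η (G p))) :
    Nonempty (LegData Ω δ a η p) := by
  obtain ⟨L⟩ := hL
  have hG' := meshPoint_symm hG
  -- images of the basic sets
  have hseg : ∀ x y : ℂ, G.symm '' segment ℝ x y = segment ℝ (G.symm x) (G.symm y) := image_segment' G.symm
  have hrun : G.symm '' (L.P ∪ segment ℝ L.m L.ztop) = G.symm '' L.P ∪ segment ℝ (G.symm L.m) (G.symm L.ztop) := by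
    rw [image_union, hseg]
  have hmem : ∀ {z : ℂ} {s : Set ℂ}, z ∈ G.symm '' s ↔ G z ∈ s := fun {z s} => by
    constructor
    · rintro ⟨w, hw, rfl⟩; simpa using hw
    · intro h; exact ⟨G z, h, G.symm_apply_apply z⟩
  have hGsymm : ∀ z : ℂ, G (G.symm z) = z := G.apply_symm_apply
  -- boundary sites and adjacency along `g`
  have hB : ∀ x : Site 2, x ∈ (⟨Ω, δ, ∅, ∅⟩ : DiscreteDobrushin).zdBoundary ↔
      g x ∈ (⟨G '' Ω, δ, ∅, ∅⟩ : DiscreteDobrushin).zdBoundary := fun x => (mem_zdBoundary_map_iff hδ hG hc).symm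
  have hBsymm : ∀ x : Site 2, x ∈ (⟨G '' Ω, δ, ∅, ∅⟩ : DiscreteDobrushin).zdBoundary →
      g.symm x ∈ (⟨Ω, δ, ∅, ∅⟩ : DiscreteDobrushin).zdBoundary := fun x hx => by
    rw [hB, Equiv.apply_symm_apply]; exact hx
  -- the new data
  have hu : meshPoint δ (g.symm L.u) = G.symm (meshPoint δ L.u) := hG' _
  have hv : meshPoint δ (g.symm L.v) = G.symm (meshPoint δ L.v) := hG' _
  have hvu : meshPoint δ (g.symm L.v) - meshPoint δ (g.symm L.u) = G.symm (meshPoint δ L.v - meshPoint δ L.u) := by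
    rw [hu, hv, map_sub]
  have huv : meshPoint δ (g.symm L.u) - meshPoint δ (g.symm L.v) = G.symm (meshPoint δ L.u - meshPoint δ L.v) := by
    rw [hu, hv, map_sub]
  refine ⟨⟨G.symm L.c, G.symm L.m, G.symm L.ztop, G.symm L.pstar, G.symm L.z₀, L.ε, g.symm L.u, g.symm L.v,
    π L.mv, G.symm '' L.P, ?_, ?_, ?_, ?_, ?_, ?_, ?_, ?_, ?_, ?_, ?_, ?_, ?_, ?_, ?_, ?_, ?_, ?_, ?_, ?_, ?_,
    L.ε_pos, L.ε_le, ?_, ?_, ?_, ?_, ?_, ?_, ?_⟩⟩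
  · -- hv
    rw [L.hv, hunit]
  · -- arcP
    exact isSimpleArc_image G.symm L.arcP
  · -- m ≠ ztop
    exact fun h => L.m_ne_ztop (G.symm.injective h)
  · -- inter_eq
    rw [← hseg, ← image_inter G.symm.injective, L.inter_eq, image_singleton]
  · -- c ∈ frontier Ω
    have := L.c_mem
    rw [← image_frontier'] at this
    obtain ⟨w, hw, hwc⟩ := this
    rw [← hwc, G.symm_apply_apply]; exact hw
  · -- P \ {c} ⊆ Ω
    rintro z ⟨hz, hzc⟩
    have h1 : G z ∈ L.P \ {L.c} := ⟨hmem.1 hz, fun h => hzc (by rw [mem_singleton_iff] at h ⊢; rw [← h, G.symm_apply_apply])⟩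
    have := L.subset_Ω h1
    rwa [G.injective.mem_set_image] at this
  · -- run ⊆ Ω
    intro z hz
    rw [← hseg] at hz
    have := L.run_subset_Ω (hmem.1 hz)
    rwa [G.injective.mem_set_image] at this
  · -- window
    intro z hz
    rw [← hrun] at hz
    have := L.subset_ball (hmem.1 hz)
    rw [mem_ball] at this ⊢
    rwa [G.dist_map] at this
  · -- dist ztop p
    have := L.dist_ztop
    rwa [← G.symm.dist_map, G.symm_apply_apply] at this
  · -- mesh points of boundary sites avoid the leg
    intro x hx hxmem
    rw [← hrun, hmem, ← hG] at hxmem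
    exact L.mesh_not_mem (g x) ((hB x).1 hx) hxmem
  · exact hBsymm _ L.u_mem
  · exact hBsymm _ L.v_mem
  · -- edge
    have h := (SimpleGraph.mem_edgeSet _).1 L.edge_mem
    rw [← g.apply_symm_apply L.u, ← g.apply_symm_apply L.v, ddg_adj_map_iff hδ hG] at h
    exact (SimpleGraph.mem_edgeSet _).2 h
  · -- unique inner face
    obtain ⟨f₀, ⟨hf₀, hu₀, hv₀⟩, huniq⟩ := L.existsUnique_inner
    refine ⟨gf.symm f₀, ⟨?_, ?_, ?_⟩, ?_⟩
    · rw [← isInnerFace_map_iff hδ hG hc (Ω := Ω), Equiv.apply_symm_apply]; exact hf₀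
    · rw [← hc, Equiv.apply_symm_apply, Equiv.apply_symm_apply]; exact hu₀
    · rw [← hc, Equiv.apply_symm_apply, Equiv.apply_symm_apply]; exact hv₀
    · rintro f ⟨hf, huf, hvf⟩
      have h1 : (⟨G '' Ω, δ, ∅, ∅⟩ : DiscreteDobrushin).IsInnerFace (gf f) := (isInnerFace_map_iff hδ hG hc).2 hf
      have h2 : IsCorner L.u (gf f) := by rw [← g.apply_symm_apply L.u, hc]; exact huf
      have h3 : IsCorner L.v (gf f) := by rw [← g.apply_symm_apply L.v, hc]; exact hvf
      have := huniq (gf f) ⟨h1, h2, h3⟩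
      rw [← this, Equiv.symm_apply_apply]
  · -- pstar ∈ P
    exact hmem.2 (by rw [hGsymm]; exact L.pstar_mem)
  · -- pstar_eq
    rw [L.pstar_eq, hu, hv, ← map_add, ← LinearIsometryEquiv.map_smul]
  · -- P ⊆ closedBall c (5δ)
    rw [← LinearIsometryEquiv.image_closedBall]
    exact image_mono L.subset_closedBall
  · -- dist u c
    rw [hu, G.symm.dist_map]; exact L.dist_u_c
  · -- dist v c
    rw [hv, G.symm.dist_map]; exact L.dist_v_c
  · -- edges between boundary sites meet the leg only in pstar
    intro x hx y hy hxy z hz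
    obtain ⟨hz1, hz2⟩ := hz
    rw [mem_singleton_iff]
    have hxy' : (discreteDomainGraph (G '' Ω) δ).Adj (g x) (g y) := (ddg_adj_map_iff hδ hG).2 hxy
    have h1 : G z ∈ L.P ∪ segment ℝ L.m L.ztop := by rw [← hrun] at hz1; exact hmem.1 hz1
    have h2 : G z ∈ segment ℝ (meshPoint δ (g x)) (meshPoint δ (g y)) := by
      rw [hG, hG, ← image_segment']; exact mem_image_of_mem _ hz2
    have := L.inter_edge_subset (g x) ((hB x).1 hx) (g y) ((hB y).1 hy) hxy' ⟨h1, h2⟩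
    rw [mem_singleton_iff] at this
    rw [← this, G.symm_apply_apply]
  · -- z₀ ∈ P
    exact hmem.2 (by rw [hGsymm]; exact L.z₀_mem)
  · -- ball z₀ ε ⊆ Ω
    rw [← LinearIsometryEquiv.image_ball]
    rintro _ ⟨w, hw, rfl⟩
    obtain ⟨w', hw', heq⟩ := L.ball_subset hw
    rw [← heq, G.symm_apply_apply]; exact hw'
  · -- sector
    rintro z ⟨hz1, hz2⟩
    rw [mem_setOf_eq, hvu, ← G.symm_apply_apply z, ← map_sub, LinearIsometryEquiv.inner_map_map]
    have h1 : G z ∈ L.P ∪ segment ℝ L.m L.ztop := by rw [← hrun] at hz1; exact hmem.1 hz1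
    have h2 : G z ∈ ball L.z₀ L.ε := by
      rw [← LinearIsometryEquiv.image_ball] at hz2; exact hmem.1 hz2
    exact L.inter_ball_subset ⟨h1, h2⟩
  · -- access from u
    obtain ⟨q, hq, hpos, hsub⟩ := L.access_u
    refine ⟨G.symm q, ?_, ?_, ?_⟩
    · rw [← LinearIsometryEquiv.image_ball]; exact mem_image_of_mem _ hq
    · rw [huv, ← map_sub, LinearIsometryEquiv.inner_map_map]; exact hpos
    · rw [hu, ← hseg]
      rintro _ ⟨w, hw, rfl⟩
      obtain ⟨⟨w', hw', heq⟩, hwn⟩ := hsub hw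
      refine ⟨by rw [← heq, G.symm_apply_apply]; exact hw', fun h => hwn ?_⟩
      rwa [← hrun, hmem, hGsymm] at h
  · -- access from v
    obtain ⟨q, hq, hpos, hsub⟩ := L.access_v
    refine ⟨G.symm q, ?_, ?_, ?_⟩
    · rw [← LinearIsometryEquiv.image_ball]; exact mem_image_of_mem _ hq
    · rw [hvu, ← map_sub, LinearIsometryEquiv.inner_map_map]; exact hpos
    · rw [hv, ← hseg]
      rintro _ ⟨w, hw, rfl⟩
      obtain ⟨⟨w', hw', heq⟩, hwn⟩ := hsub hw
      refine ⟨by rw [← heq, G.symm_apply_apply]; exact hw', fun h => hwn ?_⟩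
      rwa [← hrun, hmem, hGsymm] at h
  · -- box beyond v
    intro z hz hzΩ α β h0 h2 hb1 hb2 heq
    have h1 : G z ∈ L.P ∪ segment ℝ L.m L.ztop := by rw [← hrun] at hz; exact hmem.1 hz
    have hzΩ' : G z ∈ G '' Ω := mem_image_of_mem _ hzΩ
    have hGz : G z = meshPoint δ L.v + α • G (meshPoint δ (cornerUnit (π L.mv))) +
        β • G (meshPoint δ (cornerUnit (π L.mv + 1))) := by
      rw [heq, map_add, map_add, LinearIsometryEquiv.map_smul, LinearIsometryEquiv.map_smul, hv, hGsymm]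
    rw [map_meshPoint_cornerUnit hG hunit] at hGz
    rcases map_meshPoint_cornerUnit_add_one hG hunit hπ L.mv with h | h
    · rw [h] at hGz
      exact L.box_v (G z) h1 hzΩ' α β h0 h2 hb1 hb2 hGz
    · rw [h, smul_neg, ← neg_smul] at hGz
      exact L.box_v (G z) h1 hzΩ' α (-β) h0 h2 (by linarith) (by linarith) hGz
  · -- box beyond u
    intro z hz hzΩ α β h0 h2 hb1 hb2 heq
    have h1 : G z ∈ L.P ∪ segment ℝ L.m L.ztop := by rw [← hrun] at hz; exact hmem.1 hz
    have hzΩ' : G z ∈ G '' Ω := mem_image_of_mem _ hzΩ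
    have hGz : G z = meshPoint δ L.u + α • G (meshPoint δ (cornerUnit (π L.mv + 2))) +
        β • G (meshPoint δ (cornerUnit (π L.mv + 2 + 1))) := by
      rw [heq, map_add, map_add, LinearIsometryEquiv.map_smul, LinearIsometryEquiv.map_smul, hu, hGsymm]
    rw [map_meshPoint_cornerUnit_add_two hG hunit] at hGz
    rcases map_meshPoint_cornerUnit_add_two_add_one hG hunit hπ L.mv with h | h
    · rw [h] at hGz
      exact L.box_u (G z) h1 hzΩ' α β h0 h2 hb1 hb2 hGz
    · rw [h, smul_neg, ← neg_smul] at hGz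
      exact L.box_u (G z) h1 hzΩ' α (-β) h0 h2 (by linarith) (by linarith) hGz
  · -- non-degenerate
    have := L.nondeg
    rw [hu, hv, infDist_frontier_image' , infDist_frontier_image'] 
    exact this

end Transport

end Summit.CriticalPhenomena.CardyFormulaZ2.Theorems.DiscretisationFamilyExists

end
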